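import Literature.MathematicalPhysics.QuantumFieldTheory.Balaban1983to89.B13Lemma3TorusPrimitive
import Literature.MathematicalPhysics.QuantumFieldTheory.Balaban1983to89.B13Bound226LocatedPoly

/-!
# `Balaban1983to89.B13Lemma3TorusPrimitivePoly` — T. Bałaban, *Renormalization group approach to lattice gauge field
theories. II. Cluster expansions*, Commun. Math. Phys. **116** (1988) 1–22 [Balaban1988RG2Cluster], pp. 15–17: (2.26) for
one term of the torus model from the primitive objects, at PRINT'S PER-DOMAIN τ-RADII (2.18), with and without the
regularity hypotheses `hΨσ`, `hΨτ`

statement-level skeleton of published theorems with citation tags; proofs where landed; nothing here is a claim about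
the Yang–Mills mass gap

WHY (cell `pub-balaban-gaps`, seat ne5 gen 6; cell records (x8), X-H4-1).  The tree's joiner
`B13Lemma3TorusPrimitive.h226_torus_of_primitives` (the torus instance of the located (2.26) capstone, feeding
`B13Lemma3TorusTerms.hrep_of_termwise` ∕ `deliverables_torus_termwise_of_226`) types the τ-analyticity with ONE open set
`Uτ ⊇` every disc `{|z| ≤ |τ(Y)|}` — for print's growing radii `|τ(Y)| ∝ e^{(1−3δ)κd_k(Y)}` a torus-size dependent demand once
`hΨτ` is to be DERIVED from (2.20).  Here: the same joiner over `B13Bound226LocatedPoly` (per-domain regions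
`Uτ Y ⊇ {|z| ≤ |τ(Y)|}`), `h226_torus_of_primitives_polyτ` (letters `hΨσ`, `hΨτ : SepHolOnPoly Uτ`) and
`h226_torus_of_primitives_holo_polyτ` (no regularity letters: σ-letters on the open σ-polydisc, entrywise holomorphy of
`A(σ)`, `G(σ)`, measurability, (2.20) on `Π_Y Uτ Y`).  Conclusions and constant matching identical to the tree's joiner.

HONEST FRAMING.  Pure joiners (torus instance of landed abstract theorems + the p. 17 constant matching, copied from the
tree's joiner); every kernel family and letter is a HYPOTHESIS; nothing of Bałaban's constructed; (D4) 0∕1, spine 0∕9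
UNCHANGED; NOT continuum, NOT mass gap, NOT Clay.  0 sorry, 0 `def`.
-/

namespace Literature.MathematicalPhysics.QuantumFieldTheory.Balaban1983to89.B13Lemma3TorusPrimitivePoly

open Metric Set Matrix
open Literature.MathematicalPhysics.QuantumFieldTheory.Balaban1983to89
open Literature.MathematicalPhysics.QuantumFieldTheory.Balaban1983to89.TreeLengthTorus (TPt TDom tsys)
open Literature.MathematicalPhysics.QuantumFieldTheory.Balaban1983to89.TreeLengthTorusTransfer (tclosure)
open Literature.MathematicalPhysics.QuantumFieldTheory.Balaban1983to89.B13Lemma3TorusData (TBond)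
open Literature.MathematicalPhysics.QuantumFieldTheory.Balaban1983to89.B13Lemma3TorusTerms (weight Z0)
open Literature.MathematicalPhysics.QuantumFieldTheory.Balaban1983to89.B13Term214 (term214 SepHolOn core214 F214)
open Literature.MathematicalPhysics.QuantumFieldTheory.Balaban1983to89.B13Bound143 (invTau)
open Literature.MathematicalPhysics.QuantumFieldTheory.Balaban1983to89.B13CauchyDecay (two_mul_invTau_eq)
open Literature.MathematicalPhysics.QuantumFieldTheory.Balaban1983to89.B13PerturbativeStep (WeightHyp)
open Literature.MathematicalPhysics.QuantumFieldTheory.Balaban1983to89.B5TorusCover (UT)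
open Literature.MathematicalPhysics.QuantumFieldTheory.Balaban1983to89.B9Thm37GlueTorus (tdist1)
open Literature.MathematicalPhysics.QuantumFieldTheory.Balaban1983to89.B13Bound226Located (kc_l1_nonneg)
open Literature.MathematicalPhysics.QuantumFieldTheory.Balaban1983to89.B13Lemma3TorusPrimitive
  (weightHyp_tdist1 tdist1_symm kc_tdist1)
open Literature.MathematicalPhysics.QuantumFieldTheory.Balaban1983to89.B13CauchyDecayPoly (SepHolOnPoly)
open Literature.MathematicalPhysics.QuantumFieldTheory.Balaban1983to89.B13Bound226LocatedPoly
  (norm_term214_le_226_of_primitives_polyτ norm_term214_le_226_of_primitives_holo_polyτ)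

noncomputable section

section Joiner

variable {d L N' : ℕ} [NeZero L] [NeZero N'] {M : ℕ}
variable {ν : ℕ} {Nf : Fin ν → ℕ} [∀ i, NeZero (Nf i)]
variable {Λ : Type} [Fintype Λ] [DecidableEq Λ] {C₀ : Type} [Fintype C₀] [DecidableEq C₀]

open Classical in
/-- **(2.26) FOR ONE TERM of the torus model, from the PRIMITIVE objects, PER-DOMAIN τ-REGIONS** — the tree's
`B13Lemma3TorusPrimitive.h226_torus_of_primitives` with its τ-data in the poly class of `B13CauchyDecayPoly`: open regions
`Uτ Y ⊇ {|z| ≤ |τ(Y)|}` with the per-domain radii `|τ(Y)| = (invTau c (d_k Y))⁻¹` of (2.18) (one region per domain, each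
containing the contour discs), `hΨσ` for the τ of `Π_Y Uτ Y`, `hΨτ : SepHolOnPoly Uτ`; every other hypothesis, the conclusion
`‖(2.14)‖ ≤ weight L M c Z a t · exp(a₅·|Z|)` and the constant matching IDENTICAL (the torus instance of
`B13Bound226LocatedPoly.norm_term214_le_226_of_primitives_polyτ`).
[cite: Balaban1988RG2Cluster, (2.14)–(2.15) p.15, (2.16)–(2.22) p.16, (2.23)–(2.26) p.17] -/
theorem h226_torus_of_primitives_polyτ (c : B13.Consts) (hκ₁ : 1 ≤ c.κ₁) (hα₆ : c.α₆ ≠ 0)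
    (Z : TDom d N') (t : Finset (TDom d (L * N')) × Finset (TBond d M (L * N')))
    (hpos : ∀ Y : TDom d (L * N'), 0 < invTau c ((tsys d (L * N')).dj Y))
    (hhalf : ∀ Y : TDom d (L * N'), invTau c ((tsys d (L * N')).dj Y) ≤ 1 / 2)
    {Uσ : Set ℂ} {Uτ : TDom d (L * N') → Set ℂ} (hUσ : IsOpen Uσ) (hUτ : ∀ Y, IsOpen (Uτ Y))
    (hUexp : closedBall (0 : ℂ) (Real.exp c.κ₁) ⊆ Uσ)
    (hUtau : ∀ Y : TDom d (L * N'), closedBall (0 : ℂ) ((invTau c ((tsys d (L * N')).dj Y))⁻¹) ⊆ Uτ Y)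
    {r : ℝ} (hr : 0 < r) (hr' : r ≤ Real.exp c.κ₁ - 1)
    (hsubτ : ∀ Y, ∀ s ∈ Set.uIcc (0 : ℝ) 1, closedBall (s : ℂ) r ⊆ Uτ Y)
    -- the parameter lists of the term: σ over the blocks of Z∖Z′₀, τ over 𝐃
    (lZ : List (TPt d N')) (hlZ : lZ.Nodup ∧ lZ.toFinset = Z.1 \ tclosure L N' (Z0 M t))
    (lD : List (TDom d (L * N'))) (hlD : lD.Nodup ∧ lD.toFinset = t.1)
    -- the (2.14)-data of the term
    (A : (TPt d N' → ℂ) → Matrix Λ Λ ℂ) (Γ : (TPt d N' → ℂ) → (Λ ⊕ C₀ → ℝ) → (Λ → ℂ))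
    (χY₀ χcP : (Λ → ℝ) → ℝ) (hχ0 : ∀ B, 0 ≤ χY₀ B) (hχc0 : ∀ B, 0 ≤ χcP B) (Dfam : Finset (TDom d (L * N')))
    (V : TDom d (L * N') → (Λ → ℝ) → ℂ)
    (hΨσ : ∀ τ : TDom d (L * N') → ℂ, (∀ j, τ j ∈ Uτ j) →
      SepHolOn Uσ (fun σ => core214 A Γ (F214 t.2.card χY₀ χcP Dfam V) σ τ))
    (hΨτ : ∀ σ : TPt d N' → ℂ, (∀ j, σ j ∈ Uσ) →
      SepHolOnPoly Uτ (fun τ => core214 A Γ (F214 t.2.card χY₀ χcP Dfam V) σ τ))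
    {C : Matrix Λ Λ ℝ} (hC : C.PosDef) (Γ₀ : Matrix Λ (Λ ⊕ C₀) ℝ)
    (hAs : ∀ σ : TPt d N' → ℂ, (∀ j, ‖σ j‖ ≤ Real.exp c.κ₁) → (A σ).IsSymm)
    (hA : ∀ σ : TPt d N' → ℂ, (∀ j, ‖σ j‖ ≤ Real.exp c.κ₁) → ((A σ).map Complex.re).PosDef)
    -- the Γ-operator is linear with kernel G(σ)
    (G : (TPt d N' → ℂ) → Matrix Λ (Λ ⊕ C₀) ℂ)
    (hlin : ∀ σ : TPt d N' → ℂ, (∀ j, ‖σ j‖ ≤ Real.exp c.κ₁) →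
      ∀ X : Λ ⊕ C₀ → ℝ, Γ σ X = G σ *ᵥ fun j => (X j : ℂ))
    -- the (2.22) and (2.20) shapes
    {γ₂ rP a₂₀ w : ℝ} (qP : (Λ → ℝ) → ℝ)
    (h222 : ∀ B, χY₀ B * χcP B ≤ Real.exp (-(γ₂ / 2 * rP ^ 2 * (t.2.card : ℕ)) + γ₂ / 2 * qP B)) (hγ₂ : 0 ≤ γ₂)
    (hqP : ∀ B, qP B ≤ B ⬝ᵥ B)
    (h220R : ∀ B, ∑ Y ∈ Dfam, (invTau c ((tsys d (L * N')).dj Y))⁻¹ * ‖V Y B‖ ≤ a₂₀ / 2 * (B ⬝ᵥ B) + w)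
    (ha0 : 0 ≤ a₂₀)
    -- bonds located on the torus `UT Nf`
    (locΛ : Λ → UT Nf) (locN : Λ ⊕ C₀ → UT Nf) {m : ℕ}
    (hfibΛ : ∀ x : UT Nf, (Finset.univ.filter fun i => locΛ i = x).card ≤ m)
    (hfibN : ∀ x : UT Nf, (Finset.univ.filter fun j => locN j = x).card ≤ m)
    -- rates and constants
    {kap kap' kap'' θ θE θΓ θC KG KΓ KCs K₀ : ℝ} (hkap'' : 0 < kap'') (h1 : kap'' < kap') (h2 : kap' < kap)
    (hθE : 0 ≤ θE) (hθΓ : 0 ≤ θΓ) (hθC : 0 ≤ θC) (hKG : 0 ≤ KG) (hKΓ : 0 ≤ KΓ) (hKCs : 0 ≤ KCs) (hK₀ : 0 ≤ K₀)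
    (hθEle : θE ≤ θ) (hθΓle : θΓ ≤ θ)
    (hθR1le : (m * (1 + 2 / (kap - kap')) ^ ν) * (m * (1 + 2 / (kap' - kap'')) ^ ν)
      * (θΓ * KCs * KG + KΓ * θC * KG + KΓ * K₀ * θΓ) ≤ θ)
    -- uniform localisation of the primitive kernels in the torus distance (L17a)
    (hG : ∀ σ : TPt d N' → ℂ, (∀ j, ‖σ j‖ ≤ Real.exp c.κ₁) →
      ∀ b j, ‖G σ b j‖ ≤ KG * Real.exp (-(kap * tdist1 Nf (locΛ b) (locN j))))
    (hΓ₀ : ∀ b j, ‖Γ₀ b j‖ ≤ KΓ * Real.exp (-(kap * tdist1 Nf (locΛ b) (locN j))))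
    (hCs : ∀ σ : TPt d N' → ℂ, (∀ j, ‖σ j‖ ≤ Real.exp c.κ₁) →
      ∀ b b', ‖(A σ)⁻¹ b b'‖ ≤ KCs * Real.exp (-(kap * tdist1 Nf (locΛ b) (locΛ b'))))
    (hC216 : ∀ b b', ‖C b b'‖ ≤ K₀ * Real.exp (-(kap * tdist1 Nf (locΛ b) (locΛ b'))))
    -- the (2.16)-type differences of the primitive kernels in the torus distance (L16a)
    (hdΓ : ∀ σ : TPt d N' → ℂ, (∀ j, ‖σ j‖ ≤ Real.exp c.κ₁) →
      ∀ b j, ‖(G σ - Γ₀.map (algebraMap ℝ ℂ)) b j‖ ≤ θΓ * Real.exp (-(kap * tdist1 Nf (locΛ b) (locN j))))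
    (hdC : ∀ σ : TPt d N' → ℂ, (∀ j, ‖σ j‖ ≤ Real.exp c.κ₁) →
      ∀ b b', ‖((A σ)⁻¹ - C.map (algebraMap ℝ ℂ)) b b'‖
        ≤ θC * Real.exp (-(kap * tdist1 Nf (locΛ b) (locΛ b'))))
    (hdE : ∀ σ : TPt d N' → ℂ, (∀ j, ‖σ j‖ ≤ Real.exp c.κ₁) →
      ∀ b b', ‖(A σ - C⁻¹.map (algebraMap ℝ ℂ)) b b'‖ ≤ θE * Real.exp (-(kap * tdist1 Nf (locΛ b) (locΛ b'))))
    (hsmallKθ : K₀ * (m * (1 + 2 / kap) ^ ν) * (θ * (m * (1 + 2 / kap'') ^ ν)) < 1)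
    -- the (2.24)–(2.25) smallness
    {cE g : ℝ} (hc0 : 0 ≤ cE) (hc : ∀ k, hC.1.eigenvalues k ≤ cE)
    (hαc : (2 * (θ * (m * (1 + 2 / kap'') ^ ν)) + (γ₂ + a₂₀)) * cE ≤ 1 / 2) (hg : 0 ≤ g)
    (hΓq : ∀ X : Λ ⊕ C₀ → ℝ, (Γ₀ *ᵥ X) ⬝ᵥ (C *ᵥ (Γ₀ *ᵥ X)) ≤ g * (X ⬝ᵥ X))
    (hsmall : (2 * (θ * (m * (1 + 2 / kap'') ^ ν)) + (γ₂ + a₂₀)) * (1 + 2 * cE * g) ≤ 1 / 2)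
    -- constant matching, p. 17: the |P|-rate of the weight and «exp O(1)α₅|Z|»
    {a a₅ : ℝ} (hPa : a ≤ γ₂ * rP ^ 2)
    (hvol : 2 * (K₀ * (m * (1 + 2 / kap) ^ ν) * (θ * (m * (1 + 2 / kap'') ^ ν))
              * (1 + (1 - K₀ * (m * (1 + 2 / kap) ^ ν) * (θ * (m * (1 + 2 / kap'') ^ ν)))⁻¹) / 2)
          * (Fintype.card Λ : ℝ)
        + w + (2 * (θ * (m * (1 + 2 / kap'') ^ ν)) + (γ₂ + a₂₀)) * cE * (Fintype.card Λ : ℝ)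
        + (2 * (θ * (m * (1 + 2 / kap'') ^ ν)) + (γ₂ + a₂₀)) * (1 + 2 * cE * g) * (Fintype.card (Λ ⊕ C₀) : ℝ)
        ≤ a₅ * ((Z.1).card : ℝ)) :
    ‖term214 r lZ lD (core214 A Γ (F214 t.2.card χY₀ χcP Dfam V)) 0 0‖ ≤
      weight L M c Z a t * Real.exp (a₅ * ((Z.1).card : ℝ)) := by
  obtain ⟨hlZ1, hlZ2⟩ := hlZ
  obtain ⟨hlD1, hlD2⟩ := hlD
  -- the τ-radii `|τ(Y)| = (invTau …)⁻¹ ≥ 2`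
  have hR2 : ∀ Y : TDom d (L * N'), (2 : ℝ) ≤ (invTau c ((tsys d (L * N')).dj Y))⁻¹ := fun Y => by
    rw [le_inv_comm₀ (by norm_num) (hpos Y)]; simpa [one_div] using hhalf Y
  have h := norm_term214_le_226_of_primitives_polyτ (ι := TPt d N') (κ := TDom d (L * N'))
    (weightHyp_tdist1 (N := Nf)) tdist1_symm kc_tdist1 kc_l1_nonneg hκ₁
    (fun Y : TDom d (L * N') => (invTau c ((tsys d (L * N')).dj Y))⁻¹) hR2 hUσ hUτ hUexp hUtau hr hr' hsubτ A Γ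
    t.2.card χY₀ χcP hχ0 hχc0 Dfam V hΨσ hΨτ hC Γ₀ hAs hA G hlin qP h222 hγ₂ hqP h220R ha0 locΛ locN hfibΛ hfibN
    hkap'' h1 h2 hθE hθΓ hθC hKG hKΓ hKCs hK₀ hθEle hθΓle hθR1le hG hΓ₀ hCs hC216 hdΓ hdC hdE hsmallKθ hc0 hc hαc
    hg hΓq hsmall hlZ1 hlD1 (σ₀ := 0) (fun _ => by simp) (τ₀ := 0) (fun _ => by simp)
  -- `|lZ| = #blocks(Z∖Z′₀)` and `2/|τ(Y)| = α₆ε₂e^{−(1−3δ)κd_k(Y)}`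
  have hlen : ((lZ.length : ℕ) : ℝ) = ((Z.1 \ tclosure L N' (Z0 M t)).card : ℝ) := by
    rw [← List.toFinset_card_of_nodup hlZ1, hlZ2]
  have hprod : (∏ Y ∈ lD.toFinset, 2 * ((invTau c ((tsys d (L * N')).dj Y))⁻¹)⁻¹) =
      ∏ Y ∈ t.1, c.α₆ * c.eps2 * Real.exp (-((1 - 3 * c.δ) * c.κ * (tsys d (L * N')).dj Y)) := by
    rw [hlD2]
    refine Finset.prod_congr rfl fun Y _ => ?_
    rw [inv_inv, two_mul_invTau_eq c hα₆]
    ring_nf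
  -- the volume factors and the |P|-rate (p. 17)
  have hP0 : (0 : ℝ) ≤ (t.2.card : ℕ) := Nat.cast_nonneg _
  have hPrate : -(γ₂ / 2 * rP ^ 2 * (t.2.card : ℕ)) ≤ -(a / 2 * (t.2.card : ℝ)) := by
    have := mul_le_mul_of_nonneg_right hPa hP0
    linarith
  have hGauss :
      Real.exp (2 * (K₀ * (m * (1 + 2 / kap) ^ ν) * (θ * (m * (1 + 2 / kap'') ^ ν))
              * (1 + (1 - K₀ * (m * (1 + 2 / kap) ^ ν) * (θ * (m * (1 + 2 / kap'') ^ ν)))⁻¹) / 2)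
            * (Fintype.card Λ : ℝ))
          * Real.exp (-(γ₂ / 2 * rP ^ 2 * ((t.2.card : ℕ) : ℝ)) + w)
          * (Real.exp ((2 * (θ * (m * (1 + 2 / kap'') ^ ν)) + (γ₂ + a₂₀)) * cE * (Fintype.card Λ : ℝ))
            * Real.exp ((2 * (θ * (m * (1 + 2 / kap'') ^ ν)) + (γ₂ + a₂₀)) * (1 + 2 * cE * g)
              * (Fintype.card (Λ ⊕ C₀) : ℝ))) ≤
        Real.exp (-(a / 2 * (t.2.card : ℝ))) * Real.exp (a₅ * ((Z.1).card : ℝ)) := by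
    rw [← Real.exp_add, ← Real.exp_add, ← Real.exp_add, ← Real.exp_add, Real.exp_le_exp]
    linarith
  have hF12 : 0 ≤ Real.exp (-(c.κ₁ - 1) * lZ.length) *
      ∏ Y ∈ lD.toFinset, 2 * ((invTau c ((tsys d (L * N')).dj Y))⁻¹)⁻¹ :=
    mul_nonneg (Real.exp_nonneg _)
      (Finset.prod_nonneg fun Y _ => mul_nonneg zero_le_two (inv_nonneg.2 (inv_nonneg.2 (hpos Y).le)))
  refine h.trans ((mul_le_mul_of_nonneg_left hGauss hF12).trans (le_of_eq ?_))
  rw [hprod, weight, ← hlen]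
  ring_nf

open Classical in
/-- **(2.26) FOR ONE TERM of the torus model, from the PRIMITIVE objects, PER-DOMAIN τ-REGIONS, WITHOUT THE REGULARITY
HYPOTHESES `hΨσ`, `hΨτ`** — `h226_torus_of_primitives_polyτ` with both analyticity slots DERIVED: the σ-letters on the OPEN
σ-polydisc `{σ | ∀ j, σ j ∈ Uσ}` (⊇ the closed `e^{κ₁}`-ball), entrywise holomorphy of `A(σ)`, `G(σ)` there, measurability of
`χ_{k,Y₀}`, `χᶜ_{k,P}`, `𝐕_k(Y,·)`, and (2.20) on the open per-domain region `Π_Y Uτ Y` (`h220U`, which contains the tree's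
`h220R` at the radii `|τ(Y)|`); same conclusion and constant matching (the torus instance of
`B13Bound226LocatedPoly.norm_term214_le_226_of_primitives_holo_polyτ`).
[cite: Balaban1988RG2Cluster, (2.14)–(2.15) p.15, (2.16)–(2.22) p.16, (2.23)–(2.26) p.17] -/
theorem h226_torus_of_primitives_holo_polyτ (c : B13.Consts) (hκ₁ : 1 ≤ c.κ₁) (hα₆ : c.α₆ ≠ 0)
    (Z : TDom d N') (t : Finset (TDom d (L * N')) × Finset (TBond d M (L * N')))
    (hpos : ∀ Y : TDom d (L * N'), 0 < invTau c ((tsys d (L * N')).dj Y))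
    (hhalf : ∀ Y : TDom d (L * N'), invTau c ((tsys d (L * N')).dj Y) ≤ 1 / 2)
    {Uσ : Set ℂ} {Uτ : TDom d (L * N') → Set ℂ} (hUσ : IsOpen Uσ) (hUτ : ∀ Y, IsOpen (Uτ Y))
    (hUexp : closedBall (0 : ℂ) (Real.exp c.κ₁) ⊆ Uσ)
    (hUtau : ∀ Y : TDom d (L * N'), closedBall (0 : ℂ) ((invTau c ((tsys d (L * N')).dj Y))⁻¹) ⊆ Uτ Y)
    {r : ℝ} (hr : 0 < r) (hr' : r ≤ Real.exp c.κ₁ - 1)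
    (hsubτ : ∀ Y, ∀ s ∈ Set.uIcc (0 : ℝ) 1, closedBall (s : ℂ) r ⊆ Uτ Y)
    -- the parameter lists of the term: σ over the blocks of Z∖Z′₀, τ over 𝐃
    (lZ : List (TPt d N')) (hlZ : lZ.Nodup ∧ lZ.toFinset = Z.1 \ tclosure L N' (Z0 M t))
    (lD : List (TDom d (L * N'))) (hlD : lD.Nodup ∧ lD.toFinset = t.1)
    -- the (2.14)-data of the term
    (A : (TPt d N' → ℂ) → Matrix Λ Λ ℂ) (Γ : (TPt d N' → ℂ) → (Λ ⊕ C₀ → ℝ) → (Λ → ℂ))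
    (χY₀ χcP : (Λ → ℝ) → ℝ) (hχ0 : ∀ B, 0 ≤ χY₀ B) (hχc0 : ∀ B, 0 ≤ χcP B) (Dfam : Finset (TDom d (L * N')))
    (V : TDom d (L * N') → (Λ → ℝ) → ℂ)
    {C : Matrix Λ Λ ℝ} (hC : C.PosDef) (Γ₀ : Matrix Λ (Λ ⊕ C₀) ℝ)
    -- replaces hΨσ ∕ hΨτ: entrywise holomorphy of A(σ), G(σ) on the OPEN σ-polydisc, measurability of the last line's
    -- ingredients; the σ-letters below on the open σ-polydisc {σ | ∀ j, σ j ∈ Uσ} (⊇ the closed e^{κ₁}-ball)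
    (hAhol : ∀ i j, DifferentiableOn ℂ (fun σ => A σ i j) {σ | ∀ j, σ j ∈ Uσ})
    (hχm : Measurable χY₀) (hχcm : Measurable χcP) (hVm : ∀ Y, Measurable (V Y))
    (hAs : ∀ σ : TPt d N' → ℂ, (∀ j, σ j ∈ Uσ) → (A σ).IsSymm)
    (hA : ∀ σ : TPt d N' → ℂ, (∀ j, σ j ∈ Uσ) → ((A σ).map Complex.re).PosDef)
    -- the Γ-operator is linear with kernel G(σ), entrywise holomorphic
    (G : (TPt d N' → ℂ) → Matrix Λ (Λ ⊕ C₀) ℂ)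
    (hGhol : ∀ i j, DifferentiableOn ℂ (fun σ => G σ i j) {σ | ∀ j, σ j ∈ Uσ})
    (hlin : ∀ σ : TPt d N' → ℂ, (∀ j, σ j ∈ Uσ) →
      ∀ X : Λ ⊕ C₀ → ℝ, Γ σ X = G σ *ᵥ fun j => (X j : ℂ))
    -- the (2.22) shape, and (2.20) on the open PER-DOMAIN τ-region (print's per-domain radii (2.18), torus-uniform)
    {γ₂ rP a₂₀ w : ℝ} (qP : (Λ → ℝ) → ℝ)
    (h222 : ∀ B, χY₀ B * χcP B ≤ Real.exp (-(γ₂ / 2 * rP ^ 2 * (t.2.card : ℕ)) + γ₂ / 2 * qP B)) (hγ₂ : 0 ≤ γ₂)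
    (hqP : ∀ B, qP B ≤ B ⬝ᵥ B) (ha0 : 0 ≤ a₂₀)
    (h220U : ∀ τ : TDom d (L * N') → ℂ, (∀ Y, τ Y ∈ Uτ Y) →
      ∀ B, ∑ Y ∈ Dfam, ‖τ Y‖ * ‖V Y B‖ ≤ a₂₀ / 2 * (B ⬝ᵥ B) + w)
    -- bonds located on the torus `UT Nf`
    (locΛ : Λ → UT Nf) (locN : Λ ⊕ C₀ → UT Nf) {m : ℕ}
    (hfibΛ : ∀ x : UT Nf, (Finset.univ.filter fun i => locΛ i = x).card ≤ m)
    (hfibN : ∀ x : UT Nf, (Finset.univ.filter fun j => locN j = x).card ≤ m)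
    -- rates and constants
    {kap kap' kap'' θ θE θΓ θC KG KΓ KCs K₀ : ℝ} (hkap'' : 0 < kap'') (h1 : kap'' < kap') (h2 : kap' < kap)
    (hθE : 0 ≤ θE) (hθΓ : 0 ≤ θΓ) (hθC : 0 ≤ θC) (hKG : 0 ≤ KG) (hKΓ : 0 ≤ KΓ) (hKCs : 0 ≤ KCs) (hK₀ : 0 ≤ K₀)
    (hθEle : θE ≤ θ) (hθΓle : θΓ ≤ θ)
    (hθR1le : (m * (1 + 2 / (kap - kap')) ^ ν) * (m * (1 + 2 / (kap' - kap'')) ^ ν)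
      * (θΓ * KCs * KG + KΓ * θC * KG + KΓ * K₀ * θΓ) ≤ θ)
    -- uniform localisation of the primitive kernels in the torus distance (L17a)
    (hG : ∀ σ : TPt d N' → ℂ, (∀ j, σ j ∈ Uσ) →
      ∀ b j, ‖G σ b j‖ ≤ KG * Real.exp (-(kap * tdist1 Nf (locΛ b) (locN j))))
    (hΓ₀ : ∀ b j, ‖Γ₀ b j‖ ≤ KΓ * Real.exp (-(kap * tdist1 Nf (locΛ b) (locN j))))
    (hCs : ∀ σ : TPt d N' → ℂ, (∀ j, σ j ∈ Uσ) →
      ∀ b b', ‖(A σ)⁻¹ b b'‖ ≤ KCs * Real.exp (-(kap * tdist1 Nf (locΛ b) (locΛ b'))))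
    (hC216 : ∀ b b', ‖C b b'‖ ≤ K₀ * Real.exp (-(kap * tdist1 Nf (locΛ b) (locΛ b'))))
    -- the (2.16)-type differences of the primitive kernels in the torus distance (L16a)
    (hdΓ : ∀ σ : TPt d N' → ℂ, (∀ j, σ j ∈ Uσ) →
      ∀ b j, ‖(G σ - Γ₀.map (algebraMap ℝ ℂ)) b j‖ ≤ θΓ * Real.exp (-(kap * tdist1 Nf (locΛ b) (locN j))))
    (hdC : ∀ σ : TPt d N' → ℂ, (∀ j, σ j ∈ Uσ) →
      ∀ b b', ‖((A σ)⁻¹ - C.map (algebraMap ℝ ℂ)) b b'‖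
        ≤ θC * Real.exp (-(kap * tdist1 Nf (locΛ b) (locΛ b'))))
    (hdE : ∀ σ : TPt d N' → ℂ, (∀ j, σ j ∈ Uσ) →
      ∀ b b', ‖(A σ - C⁻¹.map (algebraMap ℝ ℂ)) b b'‖ ≤ θE * Real.exp (-(kap * tdist1 Nf (locΛ b) (locΛ b'))))
    (hsmallKθ : K₀ * (m * (1 + 2 / kap) ^ ν) * (θ * (m * (1 + 2 / kap'') ^ ν)) < 1)
    -- the (2.24)–(2.25) smallness
    {cE g : ℝ} (hc0 : 0 ≤ cE) (hc : ∀ k, hC.1.eigenvalues k ≤ cE)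
    (hαc : (2 * (θ * (m * (1 + 2 / kap'') ^ ν)) + (γ₂ + a₂₀)) * cE ≤ 1 / 2) (hg : 0 ≤ g)
    (hΓq : ∀ X : Λ ⊕ C₀ → ℝ, (Γ₀ *ᵥ X) ⬝ᵥ (C *ᵥ (Γ₀ *ᵥ X)) ≤ g * (X ⬝ᵥ X))
    (hsmall : (2 * (θ * (m * (1 + 2 / kap'') ^ ν)) + (γ₂ + a₂₀)) * (1 + 2 * cE * g) ≤ 1 / 2)
    -- constant matching, p. 17: the |P|-rate of the weight and «exp O(1)α₅|Z|»
    {a a₅ : ℝ} (hPa : a ≤ γ₂ * rP ^ 2)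
    (hvol : 2 * (K₀ * (m * (1 + 2 / kap) ^ ν) * (θ * (m * (1 + 2 / kap'') ^ ν))
              * (1 + (1 - K₀ * (m * (1 + 2 / kap) ^ ν) * (θ * (m * (1 + 2 / kap'') ^ ν)))⁻¹) / 2)
          * (Fintype.card Λ : ℝ)
        + w + (2 * (θ * (m * (1 + 2 / kap'') ^ ν)) + (γ₂ + a₂₀)) * cE * (Fintype.card Λ : ℝ)
        + (2 * (θ * (m * (1 + 2 / kap'') ^ ν)) + (γ₂ + a₂₀)) * (1 + 2 * cE * g) * (Fintype.card (Λ ⊕ C₀) : ℝ)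
        ≤ a₅ * ((Z.1).card : ℝ)) :
    ‖term214 r lZ lD (core214 A Γ (F214 t.2.card χY₀ χcP Dfam V)) 0 0‖ ≤
      weight L M c Z a t * Real.exp (a₅ * ((Z.1).card : ℝ)) := by
  obtain ⟨hlZ1, hlZ2⟩ := hlZ
  obtain ⟨hlD1, hlD2⟩ := hlD
  -- the τ-radii `|τ(Y)| = (invTau …)⁻¹ ≥ 2`
  have hR2 : ∀ Y : TDom d (L * N'), (2 : ℝ) ≤ (invTau c ((tsys d (L * N')).dj Y))⁻¹ := fun Y => by
    rw [le_inv_comm₀ (by norm_num) (hpos Y)]; simpa [one_div] using hhalf Y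
  have h := norm_term214_le_226_of_primitives_holo_polyτ (ι := TPt d N') (κ := TDom d (L * N'))
    (weightHyp_tdist1 (N := Nf)) tdist1_symm kc_tdist1 kc_l1_nonneg hκ₁
    (fun Y : TDom d (L * N') => (invTau c ((tsys d (L * N')).dj Y))⁻¹) hR2 hUσ hUτ hUexp hUtau hr hr' hsubτ A Γ
    t.2.card χY₀ χcP hχ0 hχc0 Dfam V hC Γ₀ hAhol hχm hχcm hVm hAs hA G hGhol hlin qP h222 hγ₂ hqP ha0 h220U locΛ locN
    hfibΛ hfibN hkap'' h1 h2 hθE hθΓ hθC hKG hKΓ hKCs hK₀ hθEle hθΓle hθR1le hG hΓ₀ hCs hC216 hdΓ hdC hdE hsmallKθ hc0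
    hc hαc hg hΓq hsmall hlZ1 hlD1 (σ₀ := 0) (fun _ => by simp) (τ₀ := 0) (fun _ => by simp)
  -- `|lZ| = #blocks(Z∖Z′₀)` and `2/|τ(Y)| = α₆ε₂e^{−(1−3δ)κd_k(Y)}`
  have hlen : ((lZ.length : ℕ) : ℝ) = ((Z.1 \ tclosure L N' (Z0 M t)).card : ℝ) := by
    rw [← List.toFinset_card_of_nodup hlZ1, hlZ2]
  have hprod : (∏ Y ∈ lD.toFinset, 2 * ((invTau c ((tsys d (L * N')).dj Y))⁻¹)⁻¹) =
      ∏ Y ∈ t.1, c.α₆ * c.eps2 * Real.exp (-((1 - 3 * c.δ) * c.κ * (tsys d (L * N')).dj Y)) := by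
    rw [hlD2]
    refine Finset.prod_congr rfl fun Y _ => ?_
    rw [inv_inv, two_mul_invTau_eq c hα₆]
    ring_nf
  -- the volume factors and the |P|-rate (p. 17)
  have hP0 : (0 : ℝ) ≤ (t.2.card : ℕ) := Nat.cast_nonneg _
  have hPrate : -(γ₂ / 2 * rP ^ 2 * (t.2.card : ℕ)) ≤ -(a / 2 * (t.2.card : ℝ)) := by
    have := mul_le_mul_of_nonneg_right hPa hP0
    linarith
  have hGauss :
      Real.exp (2 * (K₀ * (m * (1 + 2 / kap) ^ ν) * (θ * (m * (1 + 2 / kap'') ^ ν))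
              * (1 + (1 - K₀ * (m * (1 + 2 / kap) ^ ν) * (θ * (m * (1 + 2 / kap'') ^ ν)))⁻¹) / 2)
            * (Fintype.card Λ : ℝ))
          * Real.exp (-(γ₂ / 2 * rP ^ 2 * ((t.2.card : ℕ) : ℝ)) + w)
          * (Real.exp ((2 * (θ * (m * (1 + 2 / kap'') ^ ν)) + (γ₂ + a₂₀)) * cE * (Fintype.card Λ : ℝ))
            * Real.exp ((2 * (θ * (m * (1 + 2 / kap'') ^ ν)) + (γ₂ + a₂₀)) * (1 + 2 * cE * g)
              * (Fintype.card (Λ ⊕ C₀) : ℝ))) ≤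
        Real.exp (-(a / 2 * (t.2.card : ℝ))) * Real.exp (a₅ * ((Z.1).card : ℝ)) := by
    rw [← Real.exp_add, ← Real.exp_add, ← Real.exp_add, ← Real.exp_add, Real.exp_le_exp]
    linarith
  have hF12 : 0 ≤ Real.exp (-(c.κ₁ - 1) * lZ.length) *
      ∏ Y ∈ lD.toFinset, 2 * ((invTau c ((tsys d (L * N')).dj Y))⁻¹)⁻¹ :=
    mul_nonneg (Real.exp_nonneg _)
      (Finset.prod_nonneg fun Y _ => mul_nonneg zero_le_two (inv_nonneg.2 (inv_nonneg.2 (hpos Y).le)))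
  refine h.trans ((mul_le_mul_of_nonneg_left hGauss hF12).trans (le_of_eq ?_))
  rw [hprod, weight, ← hlen]
  ring_nf

end Joiner

end

end Literature.MathematicalPhysics.QuantumFieldTheory.Balaban1983to89.B13Lemma3TorusPrimitivePoly
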